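/-
Copyright: fleet lead `ym-wcr-19456-p1` (seat prover-ym-wcr-19456-p1-g0-0), route `WeakCouplingRates`, crux
`ColdBoxTwoPointFloor` (stmt-QuantumFields-19456), toward stub S3c `stub_boxGaussianDomination` (piece S3c-i).
-/
import Summits.QuantumFields.YangMills.Theorems.WeakCouplingRates
import Literature.MathematicalPhysics.QuantumFieldTheory.WilsonPlaquetteLargeFieldTail
import Literature.MathematicalPhysics.QuantumLattice.LatticeGaugeDLRGibbsProofs

/-!
# Crux `ColdBoxTwoPointFloor`, piece S3c-i: large fields are rare in the cold-wall Wilson box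
# (the Gibbs–Laplace bound for `ymSpecification ρ β Λ 1`, and its `SU(2)` one-scale form)

First sub-lemma of the load-bearing stub S3c `stub_boxGaussianDomination` (Gaussian domination of the connected plaquette
covariance in the cold box) of the lead-reshaped birth skeleton of
`Summit.QuantumFields.YangMills.Theses.WeakCouplingRates.ColdBoxTwoPointFloor` — the large-field step (i) of the intended
one-scale proof (route thesis; ThermalRuler `Cruxes/SofteningCentreBlind/Lines/birth.lean`, stub F2, step (i)).

* `ymSpecification_one_real_le` — **the Gibbs–Laplace bound**, model-generic (`G` compact, `ρ` a continuous UNITARY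
  representation, ANY finite edge set `Λ`, FLAT boundary datum `η ≡ 1`, `β ≥ 0`): for a measurable event `E` on which the
  boundary Wilson action `S_Λ` is at least `s₀`, every radius `r ≥ 0` and every `0 < c_b ≤ Haar{‖ρ g − 1‖ ≤ r}`,
  `γ_Λ(E | 1) ≤ e^{−βs₀} · e^{8Nβr²·#Λ'} / c_b^{#Λ}` (`Λ'` = plaquettes touching `Λ`).  Numerator `≤ e^{−βs₀}`;
  normaliser `≥ e^{−8Nβr²#Λ'}·Haar(ball_r)^{#Λ}` by restricting the product Haar measure to the ball on every edge (all
  glued links, inside or frozen, are then within `r` of `1`, so every plaquette costs `≤ 8Nr²`,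
  `wilsonBoundaryAction_le_of_ball`).  No reflection positivity / chessboard estimate is available in a box, so — unlike
  the volume-uniform torus tail `WeakCouplingRatesLargeFieldTail.su2_measureReal_plaqCost_ge_le` — the bound carries the
  volume factor `c_b^{−#Λ}`; this is WHY the one-scale window of S3c has the constraint `ε > 2θ` below.
* (sibling file `WeakCouplingRatesColdBoxLargeFieldSU2`) `exists_boxState_real_le`, `exists_boxState_largeField_le` — the `SU(2)` cold box `boxState (fundamentalRep (Fin 2)) β H`
  of the leaf module with `r = β^{−1/2}`: `boxState{∃ p touching Λ : 2 − Re tr U_p ≥ s} ≤ e^{−βs}·e^{16#Λ'}·(c(√β)³)^{#Λ}`,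
  `Λ = boxEdges 4 (2H+1)`, one constant `c` (inverse of the tree's `SU(2)` small-ball constant,
  `HaarSmallBallClosedSubgroup.haar_ball_ge_specialUnitaryGroup`, exponent `dim SU(2) = 3`).
* (sibling file) `boxState_largeField_rarity` — **S3c-i(θ, ε)**: for `0 < θ`, `ε > 2θ`, eventually in `β`,
  `boxState_{⌈β^θ⌉}{∃ p : cost_p ≥ β^{2ε−1}} ≤ exp(−β^ε)` (counting `#Λ ≤ 2500β^{4θ}`, `#Λ' ≤ 75000β^{4θ}`,
  `log β ≤ β^κ/κ`).
* counting lemmas `card_plaquettesTouching_le` (`#Λ' ≤ (#Λ + d#Λ)·#{i<j}`), `card_boxEdges_four_le` (`#E_n ≤ 4n⁴`),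
  `card_plaquettesTouching_boxEdges_le` (`≤ 120 n⁴`); measurability of the large-field event.

References: the Laplace lower bound on `Z` is Bałaban's (0.15) [T. Bałaban, CMP 109 (1987) p. 254] / Chatterjee's lower bound
[S. Chatterjee, arXiv:1602.01222 §9]; the shape of the tail is L. Gross, CMP 92 (1983) Thm 3.6 without the chessboard step.
Everything is proved; no definition, no named fact; standard axioms.  NOT a statement about the mass gap.
-/

set_option autoImplicit false

noncomputable section

open MeasureTheory Finset
open scoped Matrix.Norms.L2Operator
open Literature.Probability.LatticeModels (glueWith glueWith_apply_mem glueWith_apply_not_mem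
  measurable_glueWith)
open Literature.MathematicalPhysics.QuantumLattice
open Literature.MathematicalPhysics.QuantumFieldTheory
open Literature.MathematicalPhysics.QuantumFieldTheory.Balaban1983to89.UnitaryModel
open Literature.MathematicalPhysics.QuantumFieldTheory.PlaquetteTail

namespace Summit.QuantumFields.YangMills.Theorems.WeakCouplingRates

section General

variable {d m : ℕ} [NeZero m] {G : Type*} [Group G]
variable (ρ : G →* Matrix (Fin m) (Fin m) ℂ) (hρu : ∀ g, ρ g ∈ Matrix.unitaryGroup (Fin m) ℂ)

include hρu in
/-- In the ball `‖ρ(U_e) − 1‖ ≤ r` on every edge of `ℤ^d`, every plaquette variable satisfies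
`‖ρ(U_p) − 1‖ ≤ 4r` (`|UV − 1| ≤ |U − 1| + |V − 1|` along a unitary representation). -/
theorem norm_plaquetteHolonomyZd_sub_one_le {r : ℝ} {U : LGConfig d G} (hU : ∀ e, ‖ρ (U e) - 1‖ ≤ r)
    (x : Literature.Probability.LatticeModels.Site d) (i j : Fin d) :
    ‖ρ (plaquetteHolonomyZd U x i j) - 1‖ ≤ 4 * r := by
  haveI : Nonempty (Fin m) := ⟨⟨0, Nat.pos_of_ne_zero (NeZero.ne m)⟩⟩
  have hmul := opDist1_map_mul_le ρ hρu
  have hinv := opDist1_map_inv ρ hρu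
  unfold plaquetteHolonomyZd
  have e1 : opDist1 (ρ (U (x, i) * U (x + Pi.single i 1, j) * (U (x + Pi.single j 1, i))⁻¹ * (U (x, j))⁻¹)) ≤
      opDist1 (ρ (U (x, i))) + opDist1 (ρ (U (x + Pi.single i 1, j))) +
        opDist1 (ρ (U (x + Pi.single j 1, i))) + opDist1 (ρ (U (x, j))) := by
    calc _ ≤ opDist1 (ρ (U (x, i) * U (x + Pi.single i 1, j) * (U (x + Pi.single j 1, i))⁻¹)) +
          opDist1 (ρ (U (x, j))⁻¹) := hmul _ _
      _ ≤ opDist1 (ρ (U (x, i) * U (x + Pi.single i 1, j))) + opDist1 (ρ (U (x + Pi.single j 1, i))⁻¹) +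
          opDist1 (ρ (U (x, j))⁻¹) := by gcongr; exact hmul _ _
      _ ≤ opDist1 (ρ (U (x, i))) + opDist1 (ρ (U (x + Pi.single i 1, j))) +
          opDist1 (ρ (U (x + Pi.single j 1, i))⁻¹) + opDist1 (ρ (U (x, j))⁻¹) := by gcongr; exact hmul _ _
      _ = _ := by rw [hinv, hinv]
  have := hU (x, i); have := hU (x + Pi.single i 1, j); have := hU (x + Pi.single j 1, i); have := hU (x, j)
  unfold opDist1 at e1
  linarith

include hρu in
/-- Each term of the Wilson boundary action is nonnegative: `0 ≤ N − Re tr ρ(U_p)`. -/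
theorem plaqTerm_nonneg (x : Literature.Probability.LatticeModels.Site d) (i j : Fin d) (U : LGConfig d G) :
    0 ≤ (m : ℝ) - plaquetteObs ρ x i j U :=
  actionTerm_nonneg ρ hρu _

include hρu in
/-- The Wilson boundary action is nonnegative. -/
theorem wilsonBoundaryAction_nonneg (Λ : Finset (Literature.MathematicalPhysics.QuantumLattice.ZdEdge d)) (U : LGConfig d G) :
    0 ≤ wilsonBoundaryAction ρ Λ U :=
  Finset.sum_nonneg fun _ _ => plaqTerm_nonneg ρ hρu _ _ _ U

include hρu in
/-- One plaquette's cost is at most the whole (nonnegative) boundary action. -/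
theorem plaqTerm_le_wilsonBoundaryAction {Λ : Finset (Literature.MathematicalPhysics.QuantumLattice.ZdEdge d)} {p : ZdPlaquette d}
    (hp : p ∈ plaquettesTouching Λ) (U : LGConfig d G) :
    (m : ℝ) - plaquetteObs ρ p.1 p.2.1.1 p.2.1.2 U ≤ wilsonBoundaryAction ρ Λ U :=
  Finset.single_le_sum (f := fun p : ZdPlaquette d => (m : ℝ) - plaquetteObs ρ p.1 p.2.1.1 p.2.1.2 U)
    (fun _ _ => plaqTerm_nonneg ρ hρu _ _ _ U) hp

include hρu in
/-- **Small links cost little action**: if every link is within `r` of `1` (in `ρ`), the boundary Wilson action of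
`Λ` is at most `8 N r² · #(plaquettes touching Λ)`. -/
theorem wilsonBoundaryAction_le_of_ball {r : ℝ} {U : LGConfig d G} (hU : ∀ e, ‖ρ (U e) - 1‖ ≤ r)
    (Λ : Finset (Literature.MathematicalPhysics.QuantumLattice.ZdEdge d)) :
    wilsonBoundaryAction ρ Λ U ≤ #(plaquettesTouching Λ) * (8 * m * r ^ 2) := by
  unfold wilsonBoundaryAction
  calc ∑ p ∈ plaquettesTouching Λ, ((m : ℝ) - plaquetteObs ρ p.1 p.2.1.1 p.2.1.2 U)
      ≤ ∑ _p ∈ plaquettesTouching Λ, (8 * (m : ℝ) * r ^ 2) := Finset.sum_le_sum fun q _ => by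
        have h := actionTerm_le_of_norm_le ρ hρu
          (norm_plaquetteHolonomyZd_sub_one_le ρ hρu hU q.1 q.2.1.1 q.2.1.2)
        unfold plaquetteObs
        nlinarith
    _ = _ := by rw [Finset.sum_const, nsmul_eq_mul]

omit [NeZero m] in
/-- The flat gluing of a ball configuration lies in the ball on EVERY edge (`‖ρ(1) − 1‖ = 0 ≤ r`). -/
theorem norm_glueWith_one_sub_one_le {r : ℝ} (hr : 0 ≤ r) {Λ : Finset (Literature.MathematicalPhysics.QuantumLattice.ZdEdge d)} {ζ : ↥Λ → G}
    (hζ : ∀ e, ‖ρ (ζ e) - 1‖ ≤ r) (e : Literature.MathematicalPhysics.QuantumLattice.ZdEdge d) :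
    ‖ρ (glueWith Λ ζ (fun _ => (1 : G)) e) - 1‖ ≤ r := by
  by_cases he : e ∈ Λ
  · rw [glueWith_apply_mem _ _ _ he]; exact hζ _
  · rw [glueWith_apply_not_mem _ _ _ he, map_one, sub_self, norm_zero]; exact hr

variable [TopologicalSpace G] [IsTopologicalGroup G] [CompactSpace G] [MeasurableSpace G] [BorelSpace G]
  [SecondCountableTopology G]

omit [NeZero m] [SecondCountableTopology G] in
/-- The product Haar measure of the ball configurations on the edges of `Λ` is `Haar(ball)^{#Λ}`. -/
theorem pi_ball_eq (Λ : Finset (Literature.MathematicalPhysics.QuantumLattice.ZdEdge d)) (r : ℝ) :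
    (Measure.pi fun _ : ↥Λ => haarProbability G) {ζ : ↥Λ → G | ∀ e, ‖ρ (ζ e) - 1‖ ≤ r} =
      (haarProbability G {g : G | ‖ρ g - 1‖ ≤ r}) ^ #Λ := by
  have hset : {ζ : ↥Λ → G | ∀ e, ‖ρ (ζ e) - 1‖ ≤ r} =
      Set.pi Set.univ (fun _ : ↥Λ => {g : G | ‖ρ g - 1‖ ≤ r}) := by
    ext ζ; simp
  rw [hset, Measure.pi_pi, Finset.prod_const, Finset.card_univ, Fintype.card_coe]

include hρu in
/-- **Gibbs large-field bound for the cold-wall Wilson kernel.**  Let `ρ` be a continuous unitary representation,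
`β ≥ 0`, `Λ` a finite edge set with the FLAT boundary condition `η ≡ 1`, and `E` a measurable event on which the
boundary Wilson action is at least `s₀`.  Then for every radius `r ≥ 0` and every `0 < c_b ≤ Haar{‖ρ g − 1‖ ≤ r}`,
`γ_Λ(E | 1) ≤ e^{−β s₀} · e^{8Nβr²·#Λ'} / c_b^{#Λ}`, `Λ' =` the plaquettes touching `Λ`
(numerator `≤ e^{−βs₀}`; normaliser `≥ e^{−8Nβr²#Λ'} · Haar(ball_r)^{#Λ}` by restricting the product Haar measure to the
ball on every edge — the Laplace lower bound; no reflection positivity is available in a box). -/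
theorem ymSpecification_one_real_le (hρc : Continuous ρ) {β : ℝ} (hβ : 0 ≤ β) (Λ : Finset (Literature.MathematicalPhysics.QuantumLattice.ZdEdge d))
    {E : Set (LGConfig d G)} (hE : MeasurableSet E) {s₀ : ℝ}
    (hs : ∀ U ∈ E, s₀ ≤ wilsonBoundaryAction ρ Λ U) {r : ℝ} (hr : 0 ≤ r) {cb : ℝ} (hcb : 0 < cb)
    (hball : cb ≤ (haarProbability G).real {g : G | ‖ρ g - 1‖ ≤ r}) :
    (ymSpecification ρ β Λ (fun _ => (1 : G))).real E ≤
      Real.exp (-(β * s₀)) * Real.exp (β * (#(plaquettesTouching Λ) * (8 * m * r ^ 2))) / cb ^ #Λ := by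
  set π : Measure (↥Λ → G) := Measure.pi fun _ : ↥Λ => haarProbability G with hπ
  haveI : IsProbabilityMeasure π := by rw [hπ]; infer_instance
  set η : LGConfig d G := fun _ => (1 : G) with hη
  set K : ℝ := #(plaquettesTouching Λ) * (8 * m * r ^ 2) with hK
  set S : (↥Λ → G) → ℝ := fun ζ => wilsonBoundaryAction ρ Λ (glueWith Λ ζ η) with hS
  have hF : Measurable (E.indicator (1 : LGConfig d G → ℝ)) := measurable_const.indicator hE
  rw [← integral_indicator_one hE, integral_ymSpecification ρ hρc β Λ hF]
  -- continuity / measurability of the pulled-back weight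
  have hSc : Continuous S := (continuous_wilsonBoundaryAction ρ hρc Λ).comp
    ((continuous_glueWith_prod Λ).comp (Continuous.prodMk_right η))
  have hwc : Continuous fun ζ => Real.exp (-β * S ζ) := Real.continuous_exp.comp (continuous_const.mul hSc)
  have hS0 : ∀ ζ, 0 ≤ S ζ := fun ζ => wilsonBoundaryAction_nonneg ρ hρu Λ _
  have hw1 : ∀ ζ, Real.exp (-β * S ζ) ≤ 1 := fun ζ => by
    rw [Real.exp_le_one_iff]; nlinarith [hS0 ζ]
  -- numerator
  have hnum : ∫ ζ, E.indicator (1 : LGConfig d G → ℝ) (glueWith Λ ζ η) * Real.exp (-β * S ζ) ∂π ≤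
      Real.exp (-(β * s₀)) := by
    have hpt : ∀ ζ, E.indicator (1 : LGConfig d G → ℝ) (glueWith Λ ζ η) * Real.exp (-β * S ζ) ≤
        Real.exp (-(β * s₀)) := fun ζ => by
      by_cases hζ : glueWith Λ ζ η ∈ E
      · rw [Set.indicator_of_mem hζ, Pi.one_apply, one_mul]
        exact Real.exp_le_exp.2 (by nlinarith [hs _ hζ])
      · rw [Set.indicator_of_notMem hζ, zero_mul]; exact (Real.exp_pos _).le
    calc _ ≤ ∫ _ζ, Real.exp (-(β * s₀)) ∂π := by
          refine integral_mono_of_nonneg (ae_of_all _ fun ζ => ?_) (integrable_const _) (ae_of_all _ hpt)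
          exact mul_nonneg (Set.indicator_nonneg (fun _ _ => zero_le_one) _) (Real.exp_pos _).le
      _ = Real.exp (-(β * s₀)) := by simp
  -- denominator
  set B : Set (↥Λ → G) := {ζ | ∀ e, ‖ρ (ζ e) - 1‖ ≤ r} with hB
  have hBm : MeasurableSet B := by
    have hset : B = Set.pi Set.univ (fun _ : ↥Λ => {g : G | ‖ρ g - 1‖ ≤ r}) := by ext ζ; simp [hB]
    rw [hset]
    exact MeasurableSet.univ_pi fun _ =>
      (isClosed_le ((hρc.sub continuous_const).norm) continuous_const).measurableSet
  have hπB : π.real B = ((haarProbability G).real {g : G | ‖ρ g - 1‖ ≤ r}) ^ #Λ := by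
    rw [measureReal_def, hπ, pi_ball_eq ρ Λ r, ENNReal.toReal_pow, ← measureReal_def]
  have hden : Real.exp (-(β * K)) * cb ^ #Λ ≤ ∫ ζ, Real.exp (-β * S ζ) ∂π := by
    have h1 : Real.exp (-(β * K)) * cb ^ #Λ ≤ Real.exp (-(β * K)) * π.real B := by
      rw [hπB]
      exact mul_le_mul_of_nonneg_left (pow_le_pow_left₀ hcb.le hball _) (Real.exp_pos _).le
    have h2 : Real.exp (-(β * K)) * π.real B = ∫ ζ, B.indicator (fun _ => Real.exp (-(β * K))) ζ ∂π := by
      rw [integral_indicator_const _ hBm, smul_eq_mul, mul_comm]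
    have h3 : ∫ ζ, B.indicator (fun _ => Real.exp (-(β * K))) ζ ∂π ≤ ∫ ζ, Real.exp (-β * S ζ) ∂π := by
      refine integral_mono_of_nonneg (ae_of_all _ fun ζ => ?_)
        (integrable_of_bound hwc.aestronglyMeasurable (C := 1) fun ζ => ?_) (ae_of_all _ fun ζ => ?_)
      · exact Set.indicator_nonneg (fun _ _ => (Real.exp_pos _).le) _
      · rw [abs_of_pos (Real.exp_pos _)]; exact hw1 ζ
      · by_cases hζ : ζ ∈ B
        · rw [Set.indicator_of_mem hζ]
          refine Real.exp_le_exp.2 ?_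
          have hle : S ζ ≤ K :=
            wilsonBoundaryAction_le_of_ball ρ hρu (norm_glueWith_one_sub_one_le ρ hr hζ) Λ
          nlinarith
        · rw [Set.indicator_of_notMem hζ]; exact (Real.exp_pos _).le
    exact h1.trans (h2.le.trans h3)
  have hden0 : 0 < Real.exp (-(β * K)) * cb ^ #Λ := by positivity
  -- combine
  calc (∫ ζ, E.indicator (1 : LGConfig d G → ℝ) (glueWith Λ ζ η) * Real.exp (-β * S ζ) ∂π) /
        ∫ ζ, Real.exp (-β * S ζ) ∂π
      ≤ Real.exp (-(β * s₀)) / (Real.exp (-(β * K)) * cb ^ #Λ) :=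
        div_le_div₀ (Real.exp_pos _).le hnum hden0 hden
    _ = Real.exp (-(β * s₀)) * Real.exp (β * K) / cb ^ #Λ := by
        rw [Real.exp_neg (β * K)]
        field_simp

/-! ## Counting: edges of the box and plaquettes touching an edge set -/

omit [NeZero m] in
/-- Crude count of the plaquettes touching `Λ`: `#Λ' ≤ (#Λ + #Λ·d) · #{i < j}`. -/
theorem card_plaquettesTouching_le (Λ : Finset (Literature.MathematicalPhysics.QuantumLattice.ZdEdge d)) :
    #(plaquettesTouching Λ) ≤ (#Λ + #Λ * d) * Fintype.card {p : Fin d × Fin d // p.1 < p.2} := by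
  unfold plaquettesTouching
  refine (Finset.card_filter_le _ _).trans ?_
  rw [Finset.card_product, Finset.card_univ]
  gcongr
  refine (Finset.card_union_le _ _).trans ?_
  gcongr
  · exact Finset.card_image_le
  · refine Finset.card_image_le.trans ?_
    rw [Finset.card_product, Finset.card_univ, Fintype.card_fin]

end General

end Summit.QuantumFields.YangMills.Theorems.WeakCouplingRates

end
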